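import Mathlib
import Summits.KontsevichZagierPeriods.KontsevichZagierPeriods.Theorems.TorsionLogsGKZLevelThreePairBetaArctan
import Literature.NumberTheory.Transcendental.KZDilationMove
import HarnessLib

/-!
# `BetaLinearSector` (stmt-KontsevichZagierPeriods-3897), line `fermat-sector-transport` —
# stub `stub_quarticHalf_equivalent_lorentz` (Euler's reflection at `1/4`, step 3)

The LEVEL-4 rung (`a, b, a', b' ∈ ¼ℤ`) of the crux `BetaLinearSector` (route FermatIsogeny) needs
Euler's reflection formula at `1/4`, `sin(π/4) · B(1/4, 3/4) = π`, INSIDE the Kontsevich–Zagier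
calculus.  Steps 1–2 (the neighbouring stubs) carry `B(1/4, 3/4)` to the rational representation
`H = [(0,1/2), 4((1-w)² + w²)/Q(w)]`, `Q(w) = w⁴ + (1-w)⁴`.  This file is step 3:

* `stub_quarticHalf_equivalent_lorentz` — ONE change of variables (rule 2)),
  `u = φ(w) = √2·w(1-w)/(1-2w)` from `(0,1/2)` onto `(0,∞)` (strictly increasing, `φ(0⁺) = 0`,
  `φ → +∞` at `1/2⁻`), with `φ'(w) = √2((1-w)² + w²)/(1-2w)²` and the KEY IDENTITY
  `(1-2w)² + 2w²(1-w)² = Q(w)`, i.e. `1 + φ(w)² = Q(w)/(1-2w)²`; hence the pull-back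
  `(2√2/(1+φ²))·φ' = 4((1-w)² + w²)/Q`: `H ∼ L = [(0,∞), 2√2/(1+u²)]` (the Lorentzian on the
  half-line, value `2√2 · π/2 = π·√2 = sin(π/4)⁻¹ · π`).

The map `φ` is `√2` times a `ℚ`-rational function, hence `ℚ`-semialgebraic (algebraic constants
are `ℚ`-definable, `isSemialgebraicFunOn_const_of_isAlgebraic`); its inverse on `(0,∞)` is the
explicit root `w = 1/2 - (√(2+4u²) - 2u)/(2√2)` of the quadratic `√2·w(1-w) = u(1-2w)`.
The packaging is the one-dimensional rule (2) `of_sub_of_mem_changeOfVariablesRel_dimOne`, as in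
the level-3 template `GKZLevelThree.arctanArc_equivalent_half`.  All representations are PINNED by
their domain and their integrand on it.

## References

* M. Kontsevich, D. Zagier, *Periods* (2001), §1.2 rule (2).
* G. Andrews, R. Askey, R. Roy, *Special Functions* (1999), Thm. 1.2.1 (Euler's reflection formula).
-/

noncomputable section

namespace Summit.KontsevichZagierPeriods.FermatIsogeny.BetaLinearSector.Quarters

open Set MeasureTheory
open MvPolynomial (aeval X C)
open Literature.NumberTheory.Transcendental Literature.NumberTheory.Transcendental.KZ
open Literature.ModelTheory.ExponentialFields (IsSemialgebraic)
open Summit.KontsevichZagierPeriods.HermiteRigidity.CMTwistQuasiPeriodTransfer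
  (of_sub_of_mem_changeOfVariablesRel_dimOne image_fin_one)
open Summit.KontsevichZagierPeriods.KontsevichZagierPeriods.Theorems.GKZLevelThree
  (isSemialgebraicFunOn_ratFun₁)

/-! ## The substitution `φ(w) = √2·w(1-w)/(1-2w)` -/

/-- The derivative of `φ(w) = √2·w(1-w)/(1-2w)` is `√2((1-w)² + w²)/(1-2w)²` (`w ≠ 1/2`).
[folklore] -/
theorem lorentz_hasDerivAt_subst {w : ℝ} (hw : 1 - 2 * w ≠ 0) :
    HasDerivAt (fun w : ℝ => Real.sqrt 2 * w * (1 - w) / (1 - 2 * w))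
      (Real.sqrt 2 * ((1 - w) ^ 2 + w ^ 2) / (1 - 2 * w) ^ 2) w := by
  have h1 : HasDerivAt (fun w : ℝ => Real.sqrt 2 * w * (1 - w)) (Real.sqrt 2 * (1 - 2 * w)) w := by
    have h := ((hasDerivAt_id' w).mul ((hasDerivAt_id' w).const_sub (1:ℝ))).const_mul (Real.sqrt 2)
    have e : (fun w : ℝ => Real.sqrt 2 * w * (1 - w)) = fun y => Real.sqrt 2 * (y * (1 - y)) := by
      funext y; ring
    rw [e]
    exact h.congr_deriv (by ring)
  have h2 : HasDerivAt (fun w : ℝ => 1 - 2 * w) (-2) w := by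
    simpa using ((hasDerivAt_id' w).const_mul (2:ℝ)).const_sub (1:ℝ)
  exact (h1.div h2 hw).congr_deriv (by ring)

/-- The key identity `1 + φ(w)² = Q(w)/(1-2w)²`, `Q(w) = w⁴ + (1-w)⁴ = (1-2w)² + 2w²(1-w)²`.
[folklore] -/
theorem lorentz_one_add_subst_sq {w : ℝ} (hw : 1 - 2 * w ≠ 0) :
    1 + (Real.sqrt 2 * w * (1 - w) / (1 - 2 * w)) ^ 2 = (w ^ 4 + (1 - w) ^ 4) / (1 - 2 * w) ^ 2 := by
  have hs2 : Real.sqrt 2 ^ 2 = 2 := Real.sq_sqrt two_pos.le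
  have hD : (1 - 2 * w) ^ 2 ≠ 0 := pow_ne_zero 2 hw
  rw [div_pow, mul_pow, mul_pow, hs2, eq_div_iff hD, add_mul, one_mul, div_mul_cancel₀ _ hD]
  ring

/-- `φ` is positive on `(0, 1/2)`. [folklore] -/
theorem lorentz_subst_pos {w : ℝ} (hw0 : 0 < w) (hw1 : w < 1 / 2) :
    0 < Real.sqrt 2 * w * (1 - w) / (1 - 2 * w) := by
  have hs0 : 0 < Real.sqrt 2 := Real.sqrt_pos.2 two_pos
  exact div_pos (mul_pos (mul_pos hs0 hw0) (by linarith)) (by linarith)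

/-- `φ` is injective on `(0, 1/2)`: `φ(p) = φ(q)` forces `(p-q)(1-p-q+2pq) = 0`, and
`1-p-q+2pq > 0` there. [folklore] -/
theorem lorentz_subst_injective {p q : ℝ} (hp : 0 < p ∧ p < 1 / 2) (hq : 0 < q ∧ q < 1 / 2)
    (h : Real.sqrt 2 * p * (1 - p) / (1 - 2 * p) = Real.sqrt 2 * q * (1 - q) / (1 - 2 * q)) :
    p = q := by
  have hs0 : 0 < Real.sqrt 2 := Real.sqrt_pos.2 two_pos
  have hp' : (1 - 2 * p) ≠ 0 := by have := hp.2; exact (by linarith : (0:ℝ) < 1 - 2 * p).ne'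
  have hq' : (1 - 2 * q) ≠ 0 := by have := hq.2; exact (by linarith : (0:ℝ) < 1 - 2 * q).ne'
  rw [div_eq_div_iff hp' hq'] at h
  have h0 : Real.sqrt 2 * ((p - q) * (1 - p - q + 2 * p * q)) = 0 := by linear_combination h
  rcases mul_eq_zero.1 h0 with h1 | h1
  · exact absurd h1 hs0.ne'
  · rcases mul_eq_zero.1 h1 with h2 | h2
    · linarith
    · have : 0 < p * q := mul_pos hp.1 hq.1
      nlinarith [hp.2, hq.2]

/-- `φ` maps `(0, 1/2)` ONTO `(0, ∞)`: for `u > 0` the quadratic `√2·w(1-w) = u(1-2w)` has the root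
`w = 1/2 - (√(2+4u²) - 2u)/(2√2) ∈ (0, 1/2)`. [folklore] -/
theorem lorentz_exists_subst_eq {u : ℝ} (hu : 0 < u) :
    ∃ w : ℝ, 0 < w ∧ w < 1 / 2 ∧ Real.sqrt 2 * w * (1 - w) / (1 - 2 * w) = u := by
  set s := Real.sqrt 2 with hs_def
  have hs0 : 0 < s := Real.sqrt_pos.2 two_pos
  have hs2 : s ^ 2 = 2 := Real.sq_sqrt two_pos.le
  set d := Real.sqrt (2 + 4 * u ^ 2) with hd_def
  have hd2 : d ^ 2 = 2 + 4 * u ^ 2 := Real.sq_sqrt (by positivity)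
  have hdu : 2 * u < d := by
    rw [hd_def, Real.lt_sqrt (by positivity)]
    nlinarith
  have hds : d < s + 2 * u := by
    rw [hd_def, Real.sqrt_lt' (by positivity)]
    nlinarith [mul_pos hs0 hu]
  have hdu0 : 0 < d - 2 * u := by linarith
  refine ⟨1 / 2 - (d - 2 * u) / (2 * s), ?_, ?_, ?_⟩
  · rw [sub_pos, div_lt_iff₀ (by positivity)]
    linarith
  · have : 0 < (d - 2 * u) / (2 * s) := div_pos hdu0 (by positivity)
    linarith
  · have h12 : 1 - 2 * (1 / 2 - (d - 2 * u) / (2 * s)) = (d - 2 * u) / s := by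
      field_simp
      ring
    have he2 : ((d - 2 * u) / (2 * s)) ^ 2 = (d - 2 * u) ^ 2 / 8 := by
      rw [div_pow, mul_pow, hs2]
      norm_num
    have hw1w : (1 / 2 - (d - 2 * u) / (2 * s)) * (1 - (1 / 2 - (d - 2 * u) / (2 * s))) =
        u * (d - 2 * u) / 2 := by
      calc (1 / 2 - (d - 2 * u) / (2 * s)) * (1 - (1 / 2 - (d - 2 * u) / (2 * s)))
          = 1 / 4 - ((d - 2 * u) / (2 * s)) ^ 2 := by ring
        _ = 1 / 4 - (d - 2 * u) ^ 2 / 8 := by rw [he2]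
        _ = u * (d - 2 * u) / 2 := by linear_combination (-1 / 8 : ℝ) * hd2
    calc s * (1 / 2 - (d - 2 * u) / (2 * s)) * (1 - (1 / 2 - (d - 2 * u) / (2 * s))) /
          (1 - 2 * (1 / 2 - (d - 2 * u) / (2 * s)))
        = s * ((1 / 2 - (d - 2 * u) / (2 * s)) * (1 - (1 / 2 - (d - 2 * u) / (2 * s)))) /
          (1 - 2 * (1 / 2 - (d - 2 * u) / (2 * s))) := by ring
      _ = s * (u * (d - 2 * u) / 2) / ((d - 2 * u) / s) := by rw [hw1w, h12]
      _ = s ^ 2 * u * (d - 2 * u) / (2 * (d - 2 * u)) := by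
          field_simp
      _ = u := by
          rw [hs2]
          field_simp

/-- The image of `(0, 1/2)` under `φ` is `(0, ∞)`. [folklore] -/
theorem lorentz_image_subst :
    (fun w : ℝ => Real.sqrt 2 * w * (1 - w) / (1 - 2 * w)) '' Ioo 0 (1 / 2) = Ioi 0 := by
  ext u
  constructor
  · rintro ⟨w, hw, rfl⟩
    exact lorentz_subst_pos hw.1 hw.2
  · intro hu
    obtain ⟨w, hw0, hw1, hwu⟩ := lorentz_exists_subst_eq (u := u) hu
    exact ⟨w, ⟨hw0, hw1⟩, hwu⟩

/-- The pull-back identity of step 3: for `0 < w < 1/2`,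
`(2√2/(1+φ(w)²)) · |φ'(w)| = 4((1-w)² + w²)/(w⁴ + (1-w)⁴)`. [folklore] -/
theorem lorentz_pullback {w : ℝ} (hw : 0 < w ∧ w < 1 / 2) :
    2 * Real.sqrt 2 / (1 + (Real.sqrt 2 * w * (1 - w) / (1 - 2 * w)) ^ 2) *
        |Real.sqrt 2 * ((1 - w) ^ 2 + w ^ 2) / (1 - 2 * w) ^ 2| =
      4 * ((1 - w) ^ 2 + w ^ 2) / (w ^ 4 + (1 - w) ^ 4) := by
  obtain ⟨hw0, hw1⟩ := hw
  have hD : 0 < 1 - 2 * w := by linarith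
  have hN : 0 < (1 - w) ^ 2 + w ^ 2 := by positivity
  have hQ : 0 < w ^ 4 + (1 - w) ^ 4 := by positivity
  have hs0 : 0 < Real.sqrt 2 := Real.sqrt_pos.2 two_pos
  have hs2 : Real.sqrt 2 ^ 2 = 2 := Real.sq_sqrt two_pos.le
  rw [abs_of_pos (div_pos (mul_pos hs0 hN) (pow_pos hD 2)), lorentz_one_add_subst_sq hD.ne',
    div_div_eq_mul_div]
  field_simp
  rw [hs2]
  ring

/-! ## Step 3: `H ∼ L` by ONE change of variables -/

/-- **Step 3 of Euler's reflection at `1/4`.**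
`[(0,1/2), 4((1-w)²+w²)/(w⁴+(1-w)⁴)] ∼ [(0,∞), 2√2/(1+u²)]` by ONE change of variables
`u = φ(w) = √2·w(1-w)/(1-2w)` (rule 2)): `√2` times a `ℚ`-rational function (hence
`ℚ`-semialgebraic, `√2` being algebraic), injective on `(0,1/2)` with image `(0,∞)`, derivative
`√2((1-w)²+w²)/(1-2w)² > 0`, and the pull-back identity `lorentz_pullback`
(`1 + φ² = (w⁴+(1-w)⁴)/(1-2w)²`). [cite: KontsevichZagier2001, §1.2 rule (2)] -/
theorem stub_quarticHalf_equivalent_lorentz : ∀ (H L : KZ.IntegralRep 1), H.domain = {x | 0 < x 0 ∧ x 0 < 1 / 2} → Set.EqOn H.integrand (fun x => 4 * ((1 - x 0) ^ 2 + (x 0) ^ 2) / ((x 0) ^ 4 + (1 - x 0) ^ 4)) H.domain → L.domain = {x | 0 < x 0} → Set.EqOn L.integrand (fun x => 2 * Real.sqrt 2 / (1 + (x 0) ^ 2)) L.domain → KZ.Equivalent H L := by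
  intro H L hHd hHi hLd hLi
  set φ : ℝ → ℝ := fun w => Real.sqrt 2 * w * (1 - w) / (1 - 2 * w) with hφ
  set φ' : ℝ → ℝ := fun w => Real.sqrt 2 * ((1 - w) ^ 2 + w ^ 2) / (1 - 2 * w) ^ 2 with hφ'
  have hsqrt2 : IsAlgebraic ℚ (Real.sqrt 2) := by
    refine ⟨Polynomial.X ^ 2 - Polynomial.C 2, Polynomial.X_pow_sub_C_ne_zero two_pos 2, ?_⟩
    simp [Real.sq_sqrt (by norm_num : (0:ℝ) ≤ 2)]
  have hmem : ∀ p ∈ H.domain, 0 < p 0 ∧ p 0 < 1 / 2 := fun p hp => by rw [hHd] at hp; exact hp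
  refine changeOfVariablesRel_subset_relations
    (of_sub_of_mem_changeOfVariablesRel_dimOne H L φ φ' ?_ ?_ ?_ ?_ ?_)
  · -- semialgebraic: `√2` (algebraic constant) times a `ℚ`-rational function of `p 0`
    have hs := H.isSemialgebraic_domain
    have h1 : IsSemialgebraicFunOn ℚ H.domain (fun _ => Real.sqrt 2) :=
      isSemialgebraicFunOn_const_of_isAlgebraic hs hsqrt2
    have h2 : IsSemialgebraicFunOn ℚ H.domain
        (fun p => (fun w : ℝ => w * (1 - w) / (1 - 2 * w)) (p 0)) := by
      refine isSemialgebraicFunOn_ratFun₁ hs (X 0 * (1 - X 0)) (1 - C 2 * X 0)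
        (fun w : ℝ => w * (1 - w) / (1 - 2 * w)) (fun x hx => ?_) (fun x _ => ?_)
      · simp only [map_sub, map_mul, MvPolynomial.aeval_C, MvPolynomial.aeval_X, map_one,
          eq_ratCast, Rat.cast_ofNat]
        have := (hmem x hx).2
        exact (by linarith : (0:ℝ) < 1 - 2 * x 0).ne'
      · simp
    exact (IsSemialgebraicFunOn.mul_holds h1 h2).congr fun p _ => by
      simp only [hφ, Pi.mul_apply]
      ring
  · -- derivative
    intro p hp
    have := (hmem p hp).2
    exact lorentz_hasDerivAt_subst (by exact (by linarith : (0:ℝ) < 1 - 2 * p 0).ne')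
  · -- injective
    intro p hp q hq h
    exact lorentz_subst_injective (hmem p hp) (hmem q hq) h
  · -- image
    rw [hLd, hHd]
    exact (image_fin_one lorentz_image_subst).symm
  · -- integrands
    intro p hp
    have hp' := hmem p hp
    have hφp : (fun _ : Fin 1 => φ (p 0)) ∈ L.domain := by
      rw [hLd]
      exact lorentz_subst_pos hp'.1 hp'.2
    rw [hHi hp, hLi hφp]
    exact (lorentz_pullback hp').symm

end Summit.KontsevichZagierPeriods.FermatIsogeny.BetaLinearSector.Quarters

end
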